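import Literature.IUT.HodgeTheaters.InitialThetaDataOfModel
import Literature.IUT.LogVolume.LambdaLineGalois
import Literature.IUT.LogVolume.Corollary22TateInput
import Literature.NumberTheory.EllipticCurves.LegendreDescentProofs
import HarnessLib

/-!
# Initial Θ-data for a point of the `λ`-line: the `F_mod`-model and the embedding `F_tpd ↪ F`

Mochizuki, *Inter-universal Teichmüller theory IV*, RIMS manuscript (Apr. 2020; = PRIMS **57** (2021)),
Cor. 2.2 (ii), p. 42: "Write `F_mod` for the minimal field of definition of the corresponding point
`∈ M_ell(ℚ̄)` and `F_mod ⊆ F_tpd := F_mod(E_{F_mod}[2]) ⊆ F` for the “tripodal” intermediate field obtained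
from `F_mod` by adjoining the fields of definition of the 2-torsion points of any model of `E_F ×_F ℚ̄` over
`F_mod` … `F = F_mod(√−1, E_{F_mod}[2·3·5])`", and p. 46 (P7): "`E_F` and `F_mod` arise as the “`E_F`” and
“`F_mod`” for a collection of initial Θ-data".

This file connects the tree's model of the `λ`-line (`GenEll.NFPoint`: `λ = P.x` presented over
`F_tpd = P.F = ℚ(λ)`, `F_mod = ℚ(j(λ)) ⊆ F_tpd`, `Cor22.UP`) with the arithmetic half of (P7) built in
`InitialThetaDataOfModel.lean` (`E_F := W ⊗ F` for an `F_mod`-MODEL `W`, `F := F_mod(√−1, W[2·3·5])` —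
the reading under which `F/F_mod` is Galois, [IUTchI] Def. 3.1 (b); route finding F-L5t7-1):

* `FMod P := ℚ(j(λ))` (a number field), `modCurve P := WeierstrassCurve.ofJ j(λ)` — an elliptic curve
  over `F_mod` with `j = j(λ)` (`modCurve_j`), so `F_mod = ℚ(j(W))` (`adjoin_modCurve_j_eq_top`, the
  hypothesis `hgen` of `exists_initialThetaData_ofModel`);
* `exists_j_eq_jInv`: `E_F = W ⊗ F` has a Legendre parameter in `F` (`j(E_F) = j(μ)`, `μ ∈ F ∖ {0,1}`:
  `W[2] ⊆ W[30]` is `F`-rational, [IUTchIV] Prop. 1.8 (vi) in the form `LegendreDescentProofs`), hence the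
  fibre sextic `256(X²−X+1)³ − j·X²(X−1)²` of `j = j(W)` SPLITS in `F` (`splits_anharmonicPoly_thetaF`,
  via `Cor22.splits_anharmonicPoly_jInv`);
* **`nonempty_algHom_tpd`** / `tpdEmb`: for `P ∈ U_P` minimally presented, an `F_mod`-embedding
  `F_tpd = F_mod(λ) ↪ F` (the minimal polynomial of `λ` over `F_mod` divides the fibre sextic, which splits
  in `F`; Mathlib `IntermediateField.nonempty_algHom_of_adjoin_splits`) — "`F_tpd ⊆ F`";
* over this embedding `F/F_tpd` is Galois (`isGalois_tpd`, from `F/F_mod` Galois), `[F : F_tpd]` divides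
  `[F : F_mod] ∣ 2^{11}·3^3·5` so is prime to every prime `l ≥ 7` (`not_dvd_finrank_tpd`), and
  `j(E_F) = j(λ)` read in `F` (`modelCurve_j_eq_algebraMap_jInv`) — the three inputs of the `λ`-line ↔
  `M_ell` dictionary of `Corollary22FullGaloisImage.lean`.

Construction file (definitions + proofs) for the route definition item D1 «ThetaDataExists(P,l)»; TAKES NO
SIDE on anything disputed (classical field theory only).
-/

noncomputable section

open scoped Classical
open Polynomial IntermediateField
open Literature.NumberTheory.DiophantineGeometry.GenEll Literature.IUT.LogVolume
open Literature.NumberTheory.EllipticCurves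

namespace Literature.IUT.HodgeTheaters

/-! ## A Legendre parameter of `E_F = W ⊗ F` in `F`; the fibre sextic of `j(W)` splits in `F` -/

section Model

variable {K₀ : Type} [Field K₀] [NumberField K₀] (W : WeierstrassCurve K₀) [W.IsElliptic]

/-- The `2`-torsion of `E_F = W ⊗ F` is `F`-rational (`F ⊇ F_mod(W[2·3·5])`).
[cite: Mochizuki2012, IUTchIV Cor 2.2 (ii) p.42] -/
theorem two_torsion_rational
    (T : ((modelCurve W).baseChange (AlgebraicClosure (ThetaF W))).toAffine.Point) (hT : (2 : ℤ) • T = 0) :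
    T ∈ Set.range (WeierstrassCurve.Affine.Point.baseChange (W' := (modelCurve W).toAffine)
      (ThetaF W) (AlgebraicClosure (ThetaF W))) := by
  have h30 : (30 : ℤ) • T = 0 := by rw [show (30 : ℤ) = 15 * 2 from rfl, mul_smul, hT, zsmul_zero]
  have h30' : (30 : ℤ) • (show GeomPoints (AlgebraicClosure (ThetaF W)) (modelCurve W) from T) = 0 := h30
  exact torsion_thirty_rational W _ h30'

/-- **`E_F = W ⊗ F` has a Legendre parameter in `F`**: `j(E_F) = j(μ) = 2⁸(μ²−μ+1)³/(μ²(μ−1)²)` for some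
`μ ∈ F ∖ {0, 1}` ([IUTchIV] Prop. 1.8 (vi): the `2`-torsion being rational, `E_F` has a Legendre model
over `F`). [cite: Mochizuki2012, IUTchIV Prop 1.8 (vi) p.19] -/
theorem exists_j_eq_jInv : ∃ m : ThetaF W, m ≠ 0 ∧ m ≠ 1 ∧ (modelCurve W).j = Cor22.jInv m := by
  obtain ⟨m, h0, h1, hE, hj⟩ := (modelCurve W).exists_legendre_j_eq_of_two_torsion_rational
    (Kbar := AlgebraicClosure (ThetaF W)) (two_torsion_rational W)
  refine ⟨m, h0, h1, ?_⟩
  rw [hj]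
  exact @Cor22.j_legendre ⟨ThetaF W, m⟩ ⟨h0, h1⟩ hE

/-- **The fibre sextic `256(X²−X+1)³ − j(W)·X²(X−1)²` splits in `F`** (its roots are the six Legendre
parameters of `E_F`). [cite: Mochizuki2012, IUTchIV Cor 2.2 (ii) p.42] -/
theorem splits_anharmonicPoly_thetaF :
    ((Cor22.anharmonicPoly W.j).map (algebraMap K₀ (ThetaF W))).Splits := by
  obtain ⟨m, h0, h1, hj⟩ := exists_j_eq_jInv W
  rw [Cor22.map_anharmonicPoly, ← modelCurve_j, hj]
  exact Cor22.splits_anharmonicPoly_jInv h0 h1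

end Model

/-! ## The `F_mod`-model of a point of the `λ`-line -/

section Tripod

variable (P : NFPoint)

/-- `F_mod = ℚ(j(λ)) ⊆ F_tpd` as a field in its own right ("the minimal field of definition of the
corresponding point `∈ M_ell(ℚ̄)`", p. 42; the tree's `IntermediateField.adjoin ℚ {jInv P.x}` of
`LambdaLineGalois.lean`). [cite: Mochizuki2012, IUTchIV Cor 2.2 (ii) p.42] -/
abbrev FMod : Type := ↥(IntermediateField.adjoin ℚ ({Cor22.jInv P.x} : Set P.F))

/-- **The `F_mod`-model** `W := ofJ(j(λ))`: an elliptic curve over `F_mod` with `j`-invariant `j(λ)` ("any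
model of `E_F ×_F ℚ̄` over `F_mod`", p. 42; Mathlib `WeierstrassCurve.ofJ`).
[cite: Mochizuki2012, IUTchIV Cor 2.2 (ii) p.42] -/
def modCurve : WeierstrassCurve (FMod P) := WeierstrassCurve.ofJ (Cor22.jMod P)

/-- The `F_mod`-model is an elliptic curve. [cite: Mochizuki2012, IUTchIV Cor 2.2 (ii) p.42] -/
instance modCurve_isElliptic : (modCurve P).IsElliptic := by
  unfold modCurve; infer_instance

/-- `j(W) = j(λ)`. [cite: Mochizuki2012, IUTchIV Cor 2.2 (ii) p.42] -/
theorem modCurve_j : (modCurve P).j = Cor22.jMod P := WeierstrassCurve.ofJ_j _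

/-- `j(W) = j(λ)` read in `F_tpd`. [cite: Mochizuki2012, IUTchIV Cor 2.2 (ii) p.42] -/
theorem algebraMap_modCurve_j : algebraMap (FMod P) P.F (modCurve P).j = Cor22.jInv P.x := by
  rw [modCurve_j]; rfl

/-- **`F_mod = ℚ(j(W))`**: the `j`-invariant of the model generates `F_mod` over `ℚ` (the hypothesis `hgen`
of `exists_initialThetaData_ofModel`). [cite: Mochizuki2012, IUTchIV Cor 2.2 (ii) p.42] -/
theorem adjoin_modCurve_j_eq_top : IntermediateField.adjoin ℚ ({(modCurve P).j} : Set (FMod P)) = ⊤ := by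
  -- over the intermediate field's own `ℚ`-algebra structure this is `lift`-injectivity; the two
  -- `ℚ`-algebra structures on `F_mod` agree (`Subsingleton (Algebra ℚ _)`)
  have h : @IntermediateField.adjoin ℚ _ (FMod P) _
      (IntermediateField.adjoin ℚ ({Cor22.jInv P.x} : Set P.F)).algebra' {Cor22.jMod P} = ⊤ := by
    apply IntermediateField.lift_injective
    rw [IntermediateField.lift_top, IntermediateField.lift_adjoin_simple]
    rfl
  rw [modCurve_j]
  convert h <;> exact Subsingleton.elim _ _

/-- `F_tpd = F_mod(λ)` for a minimally presented point (`ℚ(λ) = F_tpd`).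
[cite: Mochizuki2012, IUTchIV Cor 2.2 (ii) p.42] -/
theorem adjoin_fMod_x_eq_top (hmin : P.IsMinimal) :
    IntermediateField.adjoin (FMod P) ({P.x} : Set P.F) = ⊤ := by
  rw [eq_top_iff]
  intro y _
  have hy : y ∈ IntermediateField.adjoin ℚ ({P.x} : Set P.F) := by
    rw [show IntermediateField.adjoin ℚ ({P.x} : Set P.F) = ⊤ from hmin]; exact mem_top
  have hle : IntermediateField.adjoin ℚ ({P.x} : Set P.F) ≤
      (IntermediateField.adjoin (FMod P) ({P.x} : Set P.F)).restrictScalars ℚ :=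
    adjoin_simple_le_iff.mpr (mem_adjoin_simple_self (FMod P) P.x)
  exact hle hy

/-- `λ` is a root of the fibre sextic of `j(λ) ∈ F_mod`. [cite: Mochizuki2012, IUTchIV Cor 2.2 (ii) p.42] -/
theorem aeval_anharmonicPoly_x (hU : P.InU) :
    aeval P.x (Cor22.anharmonicPoly (Cor22.jMod P)) = 0 := by
  rw [aeval_def, eval₂_eq_eval_map, Cor22.map_anharmonicPoly]
  exact Cor22.eval_anharmonicPoly_jInv_self hU.1 hU.2

/-- The minimal polynomial of `λ` over `F_mod` divides the fibre sextic of `j(λ)`.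
[cite: Mochizuki2012, IUTchIV Cor 2.2 (ii) p.42] -/
theorem minpoly_x_dvd_anharmonicPoly (hU : P.InU) :
    minpoly (FMod P) P.x ∣ Cor22.anharmonicPoly (Cor22.jMod P) :=
  minpoly.dvd _ _ (aeval_anharmonicPoly_x P hU)

/-- The minimal polynomial of `λ` over `F_mod` splits in `F = F_mod(√−1, W[2·3·5])`.
[cite: Mochizuki2012, IUTchIV Cor 2.2 (ii) p.42] -/
theorem splits_minpoly_x (hU : P.InU) :
    ((minpoly (FMod P) P.x).map (algebraMap (FMod P) (ThetaF (modCurve P)))).Splits := by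
  have hs := splits_anharmonicPoly_thetaF (modCurve P)
  rw [modCurve_j] at hs
  exact hs.of_dvd (Polynomial.map_ne_zero (Cor22.anharmonicPoly_ne_zero _))
    (Polynomial.map_dvd _ (minpoly_x_dvd_anharmonicPoly P hU))

/-- **`F_tpd ⊆ F`**: for `P ∈ U_P` minimally presented there is an `F_mod`-embedding of `F_tpd = F_mod(λ)`
into `F = F_mod(√−1, W[2·3·5])` (`λ ↦` a Legendre parameter of `E_F`).
[cite: Mochizuki2012, IUTchIV Cor 2.2 (ii) p.42] -/
theorem nonempty_algHom_tpd (hP : P ∈ UP) : Nonempty (P.F →ₐ[FMod P] ThetaF (modCurve P)) :=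
  nonempty_algHom_of_adjoin_splits (S := ({P.x} : Set P.F))
    (fun s hs => by
      rw [Set.mem_singleton_iff.mp hs]
      exact ⟨Algebra.IsIntegral.isIntegral P.x, splits_minpoly_x P hP.1⟩)
    (adjoin_fMod_x_eq_top P hP.2)

/-- **The embedding `F_tpd ↪ F` over `F_mod`** (a choice). [cite: Mochizuki2012, IUTchIV Cor 2.2 (ii) p.42] -/
def tpdEmb (hP : P ∈ UP) : P.F →ₐ[FMod P] ThetaF (modCurve P) :=
  Classical.choice (nonempty_algHom_tpd P hP)

/-- `F` as an `F_tpd`-algebra through the embedding (a `def`, supplied explicitly where used: as an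
instance it would induce a second, non-defeq `F_mod`-algebra structure on `F` through `F_tpd`).
[cite: Mochizuki2012, IUTchIV Cor 2.2 (ii) p.42] -/
@[reducible] def tpdAlgebra (hP : P ∈ UP) : Algebra P.F (ThetaF (modCurve P)) :=
  (tpdEmb P hP).toRingHom.toAlgebra

/-- The algebra map of `tpdAlgebra` is the embedding. [cite: Mochizuki2012, IUTchIV Cor 2.2 (ii) p.42] -/
theorem tpdAlgebra_algebraMap (hP : P ∈ UP) (y : P.F) :
    (letI := tpdAlgebra P hP; algebraMap P.F (ThetaF (modCurve P)) y) = tpdEmb P hP y := rfl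

/-- `F_mod ⊆ F_tpd ⊆ F` is a tower (for the model's `F_mod`-structure on `F`).
[cite: Mochizuki2012, IUTchIV Cor 2.2 (ii) p.42] -/
theorem isScalarTower_tpd (hP : P ∈ UP) :
    @IsScalarTower (FMod P) P.F (ThetaF (modCurve P)) _ (tpdAlgebra P hP).toSMul
      (thetaDataField (modCurve P)).algebra'.toSMul := by
  letI := tpdAlgebra P hP
  letI : Algebra (FMod P) (ThetaF (modCurve P)) := (thetaDataField (modCurve P)).algebra'
  exact IsScalarTower.of_algebraMap_eq fun a => ((tpdEmb P hP).commutes a).symm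

/-- **`F/F_tpd` is Galois** (as `F/F_mod` is). [cite: Mochizuki2012, IUTchIV Cor 2.2 (ii) p.42] -/
theorem isGalois_tpd (hP : P ∈ UP) :
    letI := tpdAlgebra P hP; IsGalois P.F (ThetaF (modCurve P)) := by
  letI := tpdAlgebra P hP
  letI : Algebra (FMod P) (ThetaF (modCurve P)) := (thetaDataField (modCurve P)).algebra'
  haveI := isScalarTower_tpd P hP
  exact IsGalois.tower_top_of_isGalois (FMod P) P.F (ThetaF (modCurve P))

/-- `[F : F_tpd]` divides `[F : F_mod]`. [cite: Mochizuki2012, IUTchIV Cor 2.2 (ii) p.42] -/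
theorem finrank_tpd_dvd (hP : P ∈ UP) :
    (letI := tpdAlgebra P hP; Module.finrank P.F (ThetaF (modCurve P))) ∣
      Module.finrank (FMod P) (ThetaF (modCurve P)) := by
  letI := tpdAlgebra P hP
  exact Dvd.intro_left _ (@Module.finrank_mul_finrank (FMod P) P.F (ThetaF (modCurve P)) _ _ _ _ _
    (thetaDataField (modCurve P)).module' (isScalarTower_tpd P hP) _ _ _ _)

/-- **A prime `l ≥ 7` does not divide `[F : F_tpd]`** (`[F : F_mod] ∣ 2^{11}·3^3·5`; p. 24 (E3)–(E5)).
[cite: Mochizuki2012, IUTchIV Thm 1.10 proof (ii) p.24] -/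
theorem not_dvd_finrank_tpd (hP : P ∈ UP) {l : ℕ} (hl : l.Prime) (h7 : 7 ≤ l) :
    ¬ l ∣ (letI := tpdAlgebra P hP; Module.finrank P.F (ThetaF (modCurve P))) := by
  intro h
  have hcop := finrank_thetaDataField_coprime (modCurve P) hl h7
  have h1 : l ∣ Module.finrank (FMod P) (ThetaF (modCurve P)) := h.trans (finrank_tpd_dvd P hP)
  exact hl.one_lt.ne' ((Nat.coprime_comm.mp hcop).eq_one_of_dvd h1)

/-- **`j(E_F) = j(λ)` read in `F`** through the embedding `F_tpd ↪ F` (the hypothesis `hj` of the `λ`-line ↔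
`M_ell` dictionary, `Corollary22FullGaloisImage.lean`). [cite: Mochizuki2012, IUTchIV Cor 2.2 (ii) p.42] -/
theorem modelCurve_j_eq_algebraMap_jInv (hP : P ∈ UP) :
    (modelCurve (modCurve P)).j =
      (letI := tpdAlgebra P hP; algebraMap P.F (ThetaF (modCurve P)) (Cor22.jInv P.x)) := by
  rw [tpdAlgebra_algebraMap, modelCurve_j, ← (tpdEmb P hP).commutes]
  exact congrArg (tpdEmb P hP) (algebraMap_modCurve_j P)

end Tripod

end Literature.IUT.HodgeTheaters

end
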